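import Summits.CriticalPhenomena.PercolationContinuityZ3.Theorems.PercNearOneGluingAdditiveGluingGenPair
import Literature.Probability.Percolation.KozmaNitzanSeparatingTriple
import HarnessLib

/-!
# The STRONG four-point transfer: `Cov(F(C x), 1{x↔o}) ≥ μ(o↔y, y↮x) · (E F(C x) − E[F(C x) | x↮o, x↮y])`

Support file (`--supports stmt-CriticalPhenomena-4575`, closed crux; independent mathematics on Kozma–Nitzan's Question 8 at
`|A| = 3`), prover `prim-ineq-gen-6` (gen 14).  No definitions, no named facts, no sorries; standard axioms.
Memo `prim-ineq-gen-6/PROOF-STAR1.md` (Step 2) and `FINDING-G14.md` §4.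

Setting: one percolation `μ = prodBernoulli w`, owner `x`, observer `o`, marker `y`, `F` monotone nonnegative on vertex sets,
`f = F(C x)`, `m = ∫ f`; cells `O = {x↔o}`, `R = {x↮o} ∩ {x↮y} ∩ {o↔y}` (`= {o↔y, y↮x}`), `T₀ = {x↮o} ∩ {x↮y}`.
* `PocketCert.strong_fourPoint` — `μ(R) · (μ(T₀)·m − ∫_{T₀} f) ≤ μ(T₀) · (∫_O f − μ(O)·m)`, i.e.
  `Cov(F(C x), 1{x↔o}) ≥ μ(o↔y, y↮x) · (E f − E[f | x↮o, x↮y])`.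
  This sharpens the four-point transfer `AGloc.surplusTransfer_single` (`… ≥ μ(o↔y, y↮x)·(E f − E[f | x↮y])`), since
  `E[f | x↮o, x↮y] ≤ E[f | x↮y]` (BHK positive association of `C x` given `x↮y`); it is the OBSERVER half of the proof of the one-source
  base (★₁) of the META-A2 route to the pocket covariance comparison PCOV (memo PROOF-STAR1.md): combined with the marker half
  `⟨h₁⟩_{N'} ≤ ⟨α⟩_{N'}·(E f − E[f | x↮o, x↮y])` it yields (★₁).
  PROOF: Harris for the increasing event `O ⊔ R = {o↔x} ∪ {o↔y}` (`AGloc.setIntegral_clusterFun_ge`) gives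
  `∫_O f − μ(O) m ≥ μ(R) m − ∫_R f`; van den Berg–Häggström–Kahn's Theorem 2.1 at `q = 1` for `S = {x}`, `T = {o,y}`
  (`BHK2006_twoSetConditionalAssociation.negCorrelation`: given `T₀ = {S↮T}`, `F(C x)` and `1{o↔y}` are negatively correlated) gives
  `μ(T₀) ∫_R f ≤ μ(R) ∫_{T₀} f`; multiply the first by `μ(T₀)` and insert the second.
Census: exact rational verification of both rows and of the assembled inequality on 220 random instances (`n ≤ 7`, all weight regimes;
lab-g14/verify_star1_proof_v2.py), each row an equality in 15–45 % of them.
[cite: VandenbergHaggstromKahn2005, Thm. 2.1 (p. 9), Thm. 1.4 (p. 7), §1 p. 6] [cite: KozmaNitzan2024, Question 8 (§5.5 p. 36)]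
-/

namespace Summit.CriticalPhenomena.PercolationContinuityZ3.Theorems

open MeasureTheory Set Literature.Probability.LatticeModels Literature.Probability.Percolation
open scoped Classical
open KNPreFKG

noncomputable section

namespace PocketCert

variable {V : Type*} [Fintype V]

/-- **Strong four-point transfer.**  Owner `x`, observer `o`, marker `y`, `F` monotone nonnegative on vertex sets;
`O = {x↔o}`, `R = {x↮o} ∩ {x↮y} ∩ {o↔y}`, `T₀ = {x↮o} ∩ {x↮y}`.  Then
`μ(R) · (μ(T₀) · ∫ F(C x) − ∫_{T₀} F(C x)) ≤ μ(T₀) · (∫_O F(C x) − μ(O) · ∫ F(C x))`,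
i.e. `Cov(F(C x), 1{x↔o}) ≥ μ(o↔y, y↮x) · (E F(C x) − E[F(C x) | x↮o, x↮y])`.
Harris on `{o↔x} ∪ {o↔y}` plus vdBHK Thm 2.1 (`q = 1`, `S = {x}`, `T = {o,y}`).
[cite: VandenbergHaggstromKahn2005, Thm. 2.1 (p. 9), §1 p. 6] -/
theorem strong_fourPoint (w : Sym2 V → unitInterval) (o x y : V) (F : Set V → ℝ)
    (hF : ∀ S T : Set V, S ⊆ T → F S ≤ F T) (hF0 : ∀ S, 0 ≤ F S) :
    (prodBernoulli w).real (({ω : BondConfig V | ¬ (openGraph ω).Reachable x o} ∩ {ω | ¬ (openGraph ω).Reachable x y}) ∩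
          openConn o y) *
        ((prodBernoulli w).real ({ω : BondConfig V | ¬ (openGraph ω).Reachable x o} ∩ {ω | ¬ (openGraph ω).Reachable x y}) *
            ∫ ω, F (openCluster ω x) ∂(prodBernoulli w) -
          ∫ ω in {ω : BondConfig V | ¬ (openGraph ω).Reachable x o} ∩ {ω | ¬ (openGraph ω).Reachable x y},
            F (openCluster ω x) ∂(prodBernoulli w)) ≤
      (prodBernoulli w).real ({ω : BondConfig V | ¬ (openGraph ω).Reachable x o} ∩ {ω | ¬ (openGraph ω).Reachable x y}) *
        (∫ ω in openConn x o, F (openCluster ω x) ∂(prodBernoulli w) -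
          (prodBernoulli w).real (openConn x o) * ∫ ω, F (openCluster ω x) ∂(prodBernoulli w)) := by
  classical
  set μ := prodBernoulli w with hμ
  set f : BondConfig V → ℝ := fun ω => F (openCluster ω x) with hf
  have hmeas : ∀ S' : Set (BondConfig V), MeasurableSet S' := fun _ => MeasurableSet.of_discrete
  have hint : ∀ (g : BondConfig V → ℝ) (S' : Set (BondConfig V)), IntegrableOn g S' μ :=
    fun g S' => (Integrable.of_finite).integrableOn
  have hn := fun (S' : Set (BondConfig V)) => (measureReal_nonneg : 0 ≤ μ.real S')
  -- cells
  set O : Set (BondConfig V) := openConn x o with hO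
  set T0 : Set (BondConfig V) := {ω : BondConfig V | ¬ (openGraph ω).Reachable x o} ∩ {ω | ¬ (openGraph ω).Reachable x y} with hT0
  set R : Set (BondConfig V) := T0 ∩ openConn o y with hR
  set U : Set (BondConfig V) := openConn o x ∪ openConn o y with hU
  set m : ℝ := ∫ ω, f ω ∂μ with hm
  -- `U = O ⊔ R`
  have hUeq : U = O ∪ R := by
    ext ω
    simp only [hU, hO, hR, hT0, mem_inter_iff, mem_union, mem_setOf_eq, openConn]
    constructor
    · rintro (hox | hoy)
      · exact Or.inl hox.symm
      · by_cases hxo : (openGraph ω).Reachable x o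
        · exact Or.inl hxo
        · exact Or.inr ⟨⟨hxo, fun hxy => hxo (hxy.trans hoy.symm)⟩, hoy⟩
    · rintro (hxo | ⟨⟨-, -⟩, hoy⟩)
      · exact Or.inl hxo.symm
      · exact Or.inr hoy
  have hdOR : Disjoint O R := by
    rw [Set.disjoint_left]
    rintro ω hxo ⟨⟨hxo', -⟩, -⟩
    exact hxo' hxo
  have eU : μ.real U = μ.real O + μ.real R := by rw [hUeq, measureReal_union hdOR (hmeas _)]
  have iU : ∫ ω in U, f ω ∂μ = ∫ ω in O, f ω ∂μ + ∫ ω in R, f ω ∂μ := by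
    rw [hUeq, setIntegral_union hdOR (hmeas _) (hint _ _) (hint _ _)]
  -- (1) Harris on `U = {o↔x} ∪ {o↔y}`
  have hHarris : μ.real U * m ≤ ∫ ω in U, f ω ∂μ :=
    AGloc.setIntegral_clusterFun_ge w x F hF hF0 U ((isUpperSet_openConn o x).union (isUpperSet_openConn o y))
  -- (2) van den Berg–Häggström–Kahn Thm 2.1 for `S = {x}`, `T = {o, y}`: `F(C x)` vs `1{o↔y}` given `x ↮ {o,y}`
  set S : Set V := {x} with hS
  set T : Set V := {o, y} with hT
  set Fe : Set (Sym2 V) → ℝ := fun C => F (openCluster C x) with hFe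
  set Ge : Set (Sym2 V) → ℝ := fun C => if (openGraph C).Reachable o y then 1 else 0 with hGe
  have hFe_mono : Monotone Fe := fun C C' hCC' => hF _ _ (openCluster_mono hCC' x)
  have hGe_mono : Monotone Ge := by
    intro C C' hCC'
    simp only [hGe]
    by_cases h : (openGraph C).Reachable o y
    · rw [if_pos h, if_pos (h.mono (openGraph_mono hCC'))]
    · rw [if_neg h]; split_ifs <;> norm_num
  have hD_ST : {ω : BondConfig V | ∀ s ∈ S, ∀ t ∈ T, ¬ (openGraph ω).Reachable s t} = T0 := by
    ext ω
    simp only [hS, hT, hT0, mem_setOf_eq, mem_inter_iff, mem_insert_iff, mem_singleton_iff, forall_eq_or_imp, forall_eq]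
  have hFe_eq : ∀ ω : BondConfig V, Fe (⋃ s ∈ S, openEdgeCluster ω s) = f ω := by
    intro ω
    simp only [hFe, hf]
    congr 1
    ext a
    exact (KNSep.reachable_iff_cluster ω S (show x ∈ S by simp [hS]) a).symm
  have hGe_eq : ∀ ω : BondConfig V, Ge (⋃ t ∈ T, openEdgeCluster ω t) = (openConn o y : Set (BondConfig V)).indicator 1 ω := by
    intro ω
    simp only [hGe]
    rw [← KNSep.reachable_iff_cluster ω T (show o ∈ T by simp [hT]) y]
    by_cases h : (openGraph ω).Reachable o y
    · rw [if_pos h, indicator_of_mem (show ω ∈ openConn o y from h), Pi.one_apply]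
    · rw [if_neg h, indicator_of_notMem (show ω ∉ openConn o y from h)]
  have hBHK := BHK2006_twoSetConditionalAssociation.negCorrelation w S T Fe Ge hFe_mono hGe_mono
  rw [hD_ST] at hBHK
  simp_rw [hFe_eq, hGe_eq] at hBHK
  rw [setIntegral_mul_indicator_one μ T0 (openConn o y) f, setIntegral_indicator_one_eq μ T0 (openConn o y)] at hBHK
  -- hBHK : μ T0 * ∫_R f ≤ (∫_{T0} f) * μ R     (R = T0 ∩ {o↔y})
  change μ.real T0 * ∫ ω in R, f ω ∂μ ≤ (∫ ω in T0, f ω ∂μ) * μ.real R at hBHK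
  -- assemble: μ(T0)·(∫_O f − μ(O) m) ≥ μ(T0)·(μ(R) m − ∫_R f) ≥ μ(R)·(μ(T0) m − ∫_{T0} f)
  rw [iU, eU] at hHarris
  have hA : ∫ ω in O, f ω ∂μ - μ.real O * m ≥ μ.real R * m - ∫ ω in R, f ω ∂μ := by linarith
  have hC := mul_le_mul_of_nonneg_left hA (hn T0)
  nlinarith [hBHK, hC, hn T0, hn R]

end PocketCert

end

end Summit.CriticalPhenomena.PercolationContinuityZ3.Theorems
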